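import Mathlib
import Literature.Computability.Complexity.HardCoreMinMax
import Summits.PneNP.PneNP.Theorems.Nc03AvoidResidualCoreCandCutNormCertificate

/-!
# Hoeffding for signed sums over the uniform cube — line «sfm-bl» (PROOF-SFM-BL Lemma 4)

FRONTIER F-N1c; nothing here bears on P vs NP.

For independent uniform signs `T ∈ {0,1}^m` (sign `χ(T_e) = boolSign(T_e) = ∓1`, the certificate file's convention) and real coefficients `c`, the number of
sign vectors with `Σ_e c_e χ(T_e) ≥ t` is at most `2^m · exp(−t²/(2 Σ_e c_e²))` (and symmetrically for
`≤ −t`).  In the sfm-bl argument this is applied to the discrepancy of a connected pair `(W₁, W₂)`, whose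
signed edge count is `Σ_e c_e χ(T_e)` with PAIRED coefficients `|c_e| ≤ 3` (the up-to-three legs of one
output sharing its sign), `Σ c_e² ≤ 3·e(W₁,W₂)`.  A counting corollary of the tree's weighted Hoeffding
inequality `Literature.Computability.Complexity.HardCoreMinMax.hoeffding_weighted_pi`.
-/

namespace Summit.PneNP.PneNP.Theorems.SfmBl

open Finset BigOperators

/-- The sign `χ(b) = ∓1` of a Boolean as a real number is `CandCutNorm.boolSign b` cast to `ℝ`
(`true ↦ −1`, `false ↦ +1`); its absolute value is `1`. -/
theorem abs_boolSign_cast (b : Bool) : |((CandCutNorm.boolSign b : ℤ) : ℝ)| = 1 := by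
  rcases CandCutNorm.boolSign_eq_one_or b with h | h <;> simp [h]

/-- The uniform sign has mean zero: `Σ_{b : Bool} χ(b) = 0`. -/
theorem sum_boolSign_cast : ∑ b : Bool, ((CandCutNorm.boolSign b : ℤ) : ℝ) = 0 := by
  simp [CandCutNorm.boolSign]

/-- ONE-SIDED HOEFFDING OVER THE UNIFORM CUBE (counting form): `#{T : Σ_e c_e χ(T_e) ≥ t} ≤ 2^m·e^{−t²/(2Σc²)}`. -/
theorem card_signSum_ge_le (m : ℕ) (c : Fin m → ℝ) {t : ℝ} (ht : 0 ≤ t) (hS : 0 < ∑ e, c e ^ 2) :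
    ((Finset.univ.filter (fun T : Fin m → Bool => t ≤ ∑ e, c e * ((CandCutNorm.boolSign (T e) : ℤ) : ℝ))).card : ℝ)
      ≤ 2 ^ m * Real.exp (-(t ^ 2 / (2 * ∑ e, c e ^ 2))) := by
  classical
  have h := Literature.Computability.Complexity.HardCoreMinMax.hoeffding_weighted_pi
    (ι := Fin m) (κ := fun _ => Bool) (fun _ _ => (1 / 2 : ℝ)) (fun e b => c e * ((CandCutNorm.boolSign b : ℤ) : ℝ))
    (fun e => |c e|) (fun _ _ => by norm_num) (fun _ => by norm_num)
    (fun e => by norm_num [Fintype.sum_bool, CandCutNorm.boolSign])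
    (fun e b => by rw [abs_mul, abs_boolSign_cast, mul_one]) ht (by simpa [sq_abs] using hS)
  simp only [sq_abs] at h
  -- the product weight is the constant `(1/2)^m`
  have hw : ∀ T : Fin m → Bool, (∏ _e : Fin m, (1 / 2 : ℝ)) = (1 / 2) ^ m := fun T => by simp
  rw [Finset.sum_congr rfl (fun T _ => hw T), Finset.sum_const, nsmul_eq_mul] at h
  have h2 : (0 : ℝ) < 2 ^ m := by positivity
  have : ((Finset.univ.filter (fun T : Fin m → Bool => t ≤ ∑ e, c e * ((CandCutNorm.boolSign (T e) : ℤ) : ℝ))).card : ℝ)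
      = 2 ^ m * (((Finset.univ.filter (fun T : Fin m → Bool => t ≤ ∑ e, c e * ((CandCutNorm.boolSign (T e) : ℤ) : ℝ))).card : ℝ)
          * (1 / 2) ^ m) := by
    rw [one_div, inv_pow]; field_simp
  rw [this]
  exact mul_le_mul_of_nonneg_left h h2.le

/-- The symmetric lower tail: `#{T : Σ_e c_e χ(T_e) ≤ −t} ≤ 2^m·e^{−t²/(2Σc²)}`. -/
theorem card_signSum_le_neg_le (m : ℕ) (c : Fin m → ℝ) {t : ℝ} (ht : 0 ≤ t) (hS : 0 < ∑ e, c e ^ 2) :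
    ((Finset.univ.filter (fun T : Fin m → Bool => ∑ e, c e * ((CandCutNorm.boolSign (T e) : ℤ) : ℝ) ≤ -t)).card : ℝ)
      ≤ 2 ^ m * Real.exp (-(t ^ 2 / (2 * ∑ e, c e ^ 2))) := by
  have h := card_signSum_ge_le m (fun e => -c e) ht (by simpa using hS)
  have hset : (Finset.univ.filter (fun T : Fin m → Bool => ∑ e, c e * ((CandCutNorm.boolSign (T e) : ℤ) : ℝ) ≤ -t))
      = (Finset.univ.filter (fun T : Fin m → Bool => t ≤ ∑ e, (-c e) * ((CandCutNorm.boolSign (T e) : ℤ) : ℝ))) := by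
    ext T
    simp only [Finset.mem_filter, Finset.mem_univ, true_and, neg_mul, Finset.sum_neg_distrib]
    constructor <;> intro h' <;> linarith
  rw [hset]
  simpa using h

/-- TWO-SIDED form: `#{T : |Σ_e c_e χ(T_e)| ≥ t} ≤ 2·2^m·e^{−t²/(2Σc²)}` (stated with `>`-free `≤`/`≥` events;
the union bound over the two one-sided events). -/
theorem card_abs_signSum_ge_le (m : ℕ) (c : Fin m → ℝ) {t : ℝ} (ht : 0 ≤ t) (hS : 0 < ∑ e, c e ^ 2) :
    ((Finset.univ.filter (fun T : Fin m → Bool => t ≤ |∑ e, c e * ((CandCutNorm.boolSign (T e) : ℤ) : ℝ)|)).card : ℝ)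
      ≤ 2 * (2 ^ m * Real.exp (-(t ^ 2 / (2 * ∑ e, c e ^ 2)))) := by
  classical
  have h1 := card_signSum_ge_le m c ht hS
  have h2 := card_signSum_le_neg_le m c ht hS
  have hsub : (Finset.univ.filter (fun T : Fin m → Bool => t ≤ |∑ e, c e * ((CandCutNorm.boolSign (T e) : ℤ) : ℝ)|))
      ⊆ (Finset.univ.filter (fun T : Fin m → Bool => t ≤ ∑ e, c e * ((CandCutNorm.boolSign (T e) : ℤ) : ℝ)))
        ∪ (Finset.univ.filter (fun T : Fin m → Bool => ∑ e, c e * ((CandCutNorm.boolSign (T e) : ℤ) : ℝ) ≤ -t)) := by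
    intro T hT
    simp only [Finset.mem_filter, Finset.mem_univ, true_and, Finset.mem_union] at hT ⊢
    rcases le_abs.1 hT with h | h
    · exact Or.inl h
    · exact Or.inr (by linarith)
  calc ((Finset.univ.filter (fun T : Fin m → Bool => t ≤ |∑ e, c e * ((CandCutNorm.boolSign (T e) : ℤ) : ℝ)|)).card : ℝ)
      ≤ (((Finset.univ.filter (fun T : Fin m → Bool => t ≤ ∑ e, c e * ((CandCutNorm.boolSign (T e) : ℤ) : ℝ)))
          ∪ (Finset.univ.filter (fun T : Fin m → Bool => ∑ e, c e * ((CandCutNorm.boolSign (T e) : ℤ) : ℝ) ≤ -t))).card : ℝ) := by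
        exact_mod_cast Finset.card_le_card hsub
    _ ≤ ((Finset.univ.filter (fun T : Fin m → Bool => t ≤ ∑ e, c e * ((CandCutNorm.boolSign (T e) : ℤ) : ℝ))).card : ℝ)
          + ((Finset.univ.filter (fun T : Fin m → Bool => ∑ e, c e * ((CandCutNorm.boolSign (T e) : ℤ) : ℝ) ≤ -t)).card : ℝ) := by
        exact_mod_cast Finset.card_union_le _ _
    _ ≤ _ := by linarith

end Summit.PneNP.PneNP.Theorems.SfmBl
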